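import Summits.BirchSwinnertonDyer.Rank1Residual.X2.GreenbergVatsalTateDatumCofree
import Summits.BirchSwinnertonDyer.Rank1Residual.X2.GreenbergVatsalTateFrobeniusSign
import HarnessLib

/-!
# Class X2 (odd multiplicative Eisenstein prime): the decomposition group at `p ‖ N` on `E[p]` —
# "`φ|_{G_p} ∉ {1, ω}`" at a NON-SPLIT prime, "`φ|_{G_p} ∈ {1, ω}`" at a SPLIT prime
# (cell `b2b-bsdres`, unit `b2b-bsdres-eisenstein-p2`, gen 15)

HONEST FRAMING (run/shared/lean/b2b/bsd-rank1-residual/, verbatim in every file): the goal of the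
cell is to DELETE the COMBINATION-SHAPED residual classes of the Birch–Swinnerton-Dyer formula for
ALL analytic-rank `≤ 1` elliptic curves over `ℚ` — "full BSD formula for every rank `≤ 1` curve in
class `C`" assembled STRICTLY from published theorems — so that the rank-`≤ 1` remainder becomes
exactly the CONSTRUCTION-SHAPED classes, which are TYPED (missing-input `Prop`s), NOT attempted.
This is not "finishing BSD". Research route; NO CLAIM BEYOND STATED CLASSES; nothing here changes a
label. Theorems only (no definition, no named fact, nothing asserted).

## What this file proves

Let `E₀ = W/ℚ` be globally minimal, `p` an ODD prime of multiplicative reduction, `v ∋ p` the place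
of `ℚ`, `D_v ≤ Γ_ℚ` the decomposition group of the tree's chosen prime above `v`
(`GreenbergSelmer.decomp v`, the image of `Γ_{ℚ_v}`), and `Φ ≤ E₀[p]` ANY `D_v`-stable subgroup of
order `p` (e.g. the kernel of a rational `p`-isogeny — an X2 pair is Eisenstein). Write
`X₀ = C ∩ E₀[p]` for the line cut out by the Tate datum `C = ι⁻¹Φ(μ)` of gens 9/12/13
(`GreenbergVatsalTateDatum.tateDatum`; `#X₀ = p`, `GreenbergVatsalTateDatumCofree`), granted the
PUBLISHED Tate uniformisation (Silverman *ATAEC* V.5.3/V.5.4, tree facts A40/A41, hypotheses `hT`).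

* `not_fix_and_not_quot_of_not_split` — **NON-SPLIT `p`: `D_v` neither fixes `Φ` pointwise nor acts
  trivially on `E₀[p]/Φ`** ("`φ|_{G_p} ≠ 1, ω`" for EVERY stable line: the Jordan–Hölder characters of
  `E₀[p]|_{G_p}` are `ωδ, δ` with `δ` the unramified quadratic character, `δ(Frob) = −1`). Inputs: an
  arithmetic Frobenius `τ ∈ Γ_{ℚ_v}` FLIPS `√γ` (gen 12 `frob_apply_sqrt_gamma_ne`), hence acts as
  `−1` on `E₀[p^∞]/C` (gen 12 `smul_sub_sign_smul_mem`); the inertia group moves every point of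
  `C[p]` (gen 9 `tateDatum_hgen`); `#C[p] = p` (gen 13).
* `fix_or_quot_of_split` — **SPLIT `p`: `D_v` fixes `Φ` pointwise or acts trivially on `E₀[p]/Φ`**
  (characters `ω, 1`): `D_v` acts trivially on `E₀[p^∞]/C` (gen 12 `smul_sub_mem_of_equivariant`).

Consumed by `X2/CongruentPartnerAnomalous.lean`: along a congruence `E₀[p] ≅ E₀'[p]` with a GOOD
partner `E₀'`, x1a's kernel dictionary (`Rank1Residual.anom_iff_decomposition_of_mem_primesAbove`,
Serre 1972 §1.11) turns these into `a_p(E₀') ≢ 1 (mod p)` (non-split: the covered partner of gen 14 is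
NON-ANOMALOUS, Castella–Grossi–Skinner 2025 Thm. A applies) resp. `a_p(E₀') ≡ 1 (mod p)` (split:
every good relative is ANOMALOUS — no published main conjecture on the congruence class).

References: [GreenbergVatsal2000] §2 pp. 14–15 (`C ≅ μ_{p^∞}(δ)`, `D = A/C ≅ ℚ_p/ℤ_p(δ)`);
[SilvermanATAEC1994] Ch. V Lemma 5.2 (c), Thm. 5.3, Cor. 5.4; [Serre1972] §1.12 Prop. 13 and Cor.;
HOME/b2b-bsdres-eisenstein-p2/X2-GAP.md §20.
-/

set_option autoImplicit false

noncomputable section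

open scoped Classical

open NumberField IsDedekindDomain Field WeierstrassCurve
  Literature.NumberTheory.EllipticCurves Literature.NumberTheory.GaloisRepresentations
  Literature.NumberTheory.EllipticCurves.GreenbergSelmer
  Summit.BirchSwinnertonDyer.Rank1Residual.X2.GreenbergVatsalTateDatum
  Summit.BirchSwinnertonDyer.Rank1Residual.X2.GreenbergVatsalTateDatumSign
  Summit.BirchSwinnertonDyer.Rank1Residual.X2.GreenbergVatsalTateDatumTorsion
  Summit.BirchSwinnertonDyer.Rank1Residual.X2.GreenbergVatsalTateDatumCofree
  Summit.BirchSwinnertonDyer.Rank1Residual.X2.GreenbergVatsalTateFrobeniusSign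

namespace Summit.BirchSwinnertonDyer.Rank1Residual.X2.TateLineDecomposition

variable (W : WeierstrassCurve ℚ) [W.IsElliptic] [W.IsGloballyMinimal] (p : ℕ) [hp : Fact p.Prime]
  {v : HeightOneSpectrum (𝓞 ℚ)}

/-! ## §1. The line `X₀ = M⁺ ∩ E[p]` of a local datum on `E[p^∞]`, seen inside `E[p]` -/

section Line

variable (N : LocalDatum ℚ (W.geomPrimaryTorsion p) v)

omit [W.IsElliptic] [W.IsGloballyMinimal] hp in
/-- The inclusion `E[p] ↪ E[p^∞]` is `Γ_ℚ`-equivariant. [folklore] -/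
theorem inclusion_smul (g : absoluteGaloisGroup ℚ) (P : geomTorsion W (p : ℤ)) :
    AddSubgroup.inclusion (geomTorsion_le_geomPrimaryTorsion W p) (g • P) =
      g • AddSubgroup.inclusion (geomTorsion_le_geomPrimaryTorsion W p) P :=
  Subtype.ext rfl

omit [W.IsElliptic] [W.IsGloballyMinimal] hp in
/-- `m ∈ E[p^∞][p]` iff `p • m = 0` in `E(ℚ̄)`. [folklore] -/
theorem mem_torsionBy_primary_iff (m : W.geomPrimaryTorsion p) :
    m ∈ AddSubgroup.torsionBy (↥(W.geomPrimaryTorsion p)) (p : ℤ) ↔ p • (m : W.geomPoints) = 0 := by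
  rw [AddSubgroup.torsionBy.nsmul_iff, Subtype.ext_iff, AddSubmonoidClass.coe_nsmul,
    ZeroMemClass.coe_zero]

omit [W.IsElliptic] [W.IsGloballyMinimal] hp in
/-- Membership in `X₀ = M⁺ ∩ E[p]` (as a subgroup of `E[p]`: the preimage of `M⁺` under
`E[p] ↪ E[p^∞]`). [folklore] -/
theorem mem_comap_iff (P : geomTorsion W (p : ℤ)) :
    P ∈ N.plus.comap (AddSubgroup.inclusion (geomTorsion_le_geomPrimaryTorsion W p)) ↔
      AddSubgroup.inclusion (geomTorsion_le_geomPrimaryTorsion W p) P ∈ N.plus :=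
  Iff.rfl

omit [W.IsElliptic] [W.IsGloballyMinimal] hp in
/-- `X₀` is `D_v`-stable (indeed stable under every `g` stabilising `M⁺`). [folklore] -/
theorem smul_mem_comap_of_mem_decomp {g : absoluteGaloisGroup ℚ} (hg : g ∈ decomp (K := ℚ) v)
    {P : geomTorsion W (p : ℤ)}
    (hP : P ∈ N.plus.comap (AddSubgroup.inclusion (geomTorsion_le_geomPrimaryTorsion W p))) :
    g • P ∈ N.plus.comap (AddSubgroup.inclusion (geomTorsion_le_geomPrimaryTorsion W p)) := by
  rw [mem_comap_iff, inclusion_smul]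
  exact N.smul_mem_of_mem_decomp hg hP

omit [W.IsElliptic] [W.IsGloballyMinimal] hp in
/-- **`#X₀ = #(M⁺ ∩ E[p^∞][p])`**: `E[p] ↪ E[p^∞]` maps `X₀` bijectively onto `M⁺ ⊓ E[p^∞][p]`.
[folklore] -/
theorem natCard_comap_eq :
    Nat.card (N.plus.comap (AddSubgroup.inclusion (geomTorsion_le_geomPrimaryTorsion W p))) =
      Nat.card ↥(N.plus ⊓ AddSubgroup.torsionBy (↥(W.geomPrimaryTorsion p)) (p : ℤ)) := by
  refine Nat.card_congr
    { toFun := fun P ↦ ⟨AddSubgroup.inclusion (geomTorsion_le_geomPrimaryTorsion W p) P.1,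
        ⟨P.2, ?_⟩⟩
      invFun := fun m ↦ ⟨⟨((m : W.geomPrimaryTorsion p) : W.geomPoints), ?_⟩, ?_⟩
      left_inv := fun P ↦ rfl
      right_inv := fun m ↦ rfl }
  · -- `p`-torsion
    exact (mem_torsionBy_primary_iff W p _).mpr (AddSubgroup.torsionBy.nsmul_iff.mp P.1.2)
  · exact AddSubgroup.torsionBy.nsmul_iff.mpr ((mem_torsionBy_primary_iff W p m.1).mp m.2.2)
  · exact m.2.1

omit [W.IsElliptic] [W.IsGloballyMinimal] hp in
/-- **`hgen` read inside `E[p]`**: if every point of `M⁺ ∩ E[p^∞][p]` is `τ • c' − c'` with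
`τ ∈ I_v`, `c'` in the same group (gen 9 `tateDatum_hgen`), and `X₀ ≠ 0`, then some `τ ∈ I_v` MOVES a
point of `X₀`. [cite: GreenbergVatsal2000, §2 pp. 14–15 and p. 26] -/
theorem exists_mem_inertia_smul_ne_of_hgen
    (hgen : ∀ c ∈ (GreenbergVatsalTorsion.torsionDatum N p).plus, ∃ τ ∈ inertia v,
      ∃ c' ∈ (GreenbergVatsalTorsion.torsionDatum N p).plus, τ • c' - c' = c)
    {P : geomTorsion W (p : ℤ)}
    (hP : P ∈ N.plus.comap (AddSubgroup.inclusion (geomTorsion_le_geomPrimaryTorsion W p)))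
    (hP0 : P ≠ 0) :
    ∃ τ ∈ inertia (K := ℚ) v, ∃ Q ∈ N.plus.comap
      (AddSubgroup.inclusion (geomTorsion_le_geomPrimaryTorsion W p)), τ • Q ≠ Q := by
  -- `P` as an element `c` of `E[p^∞][p]` lying in `M⁺`
  set m : W.geomPrimaryTorsion p :=
    AddSubgroup.inclusion (geomTorsion_le_geomPrimaryTorsion W p) P with hm
  have hmp : m ∈ AddSubgroup.torsionBy (↥(W.geomPrimaryTorsion p)) (p : ℤ) :=
    (mem_torsionBy_primary_iff W p m).mpr (AddSubgroup.torsionBy.nsmul_iff.mp P.2)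
  set c : AddSubgroup.torsionBy (↥(W.geomPrimaryTorsion p)) (p : ℤ) := ⟨m, hmp⟩ with hc
  have hcplus : c ∈ (GreenbergVatsalTorsion.torsionDatum N p).plus := by
    change (c : W.geomPrimaryTorsion p) ∈ N.plus
    exact hP
  obtain ⟨τ, hτ, c', hc', hτc'⟩ := hgen c hcplus
  -- `c'` as a point `Q ∈ X₀`
  have hc'p : p • ((c' : W.geomPrimaryTorsion p) : W.geomPoints) = 0 :=
    (mem_torsionBy_primary_iff W p _).mp c'.2
  set Q : geomTorsion W (p : ℤ) :=
    ⟨((c' : W.geomPrimaryTorsion p) : W.geomPoints), AddSubgroup.torsionBy.nsmul_iff.mpr hc'p⟩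
    with hQ
  have hQX : Q ∈ N.plus.comap (AddSubgroup.inclusion (geomTorsion_le_geomPrimaryTorsion W p)) := by
    rw [mem_comap_iff]
    have e : AddSubgroup.inclusion (geomTorsion_le_geomPrimaryTorsion W p) Q =
        (c' : W.geomPrimaryTorsion p) := Subtype.ext rfl
    rw [e]
    exact hc'
  refine ⟨τ, hτ, Q, hQX, fun hfix ↦ hP0 ?_⟩
  -- if `τ • Q = Q` then `c = τ c' − c' = 0`, i.e. `P = 0`
  have hval : ((τ • c' - c' : AddSubgroup.torsionBy (↥(W.geomPrimaryTorsion p)) (p : ℤ)) :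
      W.geomPrimaryTorsion p) = 0 := by
    apply Subtype.ext
    have h1 : ((τ • Q : geomTorsion W (p : ℤ)) : W.geomPoints) = (Q : W.geomPoints) := by rw [hfix]
    rw [AddSubgroup.torsionBy.coe_smul] at h1
    simp only [AddSubgroupClass.coe_sub, AddSubgroup.torsionBy.coe_smul, primaryComponent.coe_smul,
      ZeroMemClass.coe_zero]
    rw [sub_eq_zero]
    exact h1
  rw [hτc'] at hval
  have hm0 : m = 0 := by
    have : (c : W.geomPrimaryTorsion p) = 0 := hval
    exact this
  apply Subtype.ext
  have h0 := congrArg (fun x : W.geomPrimaryTorsion p ↦ (x : W.geomPoints)) hm0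
  simp only [hm, AddSubgroup.coe_inclusion, ZeroMemClass.coe_zero] at h0
  rw [ZeroMemClass.coe_zero]
  exact h0

omit [W.IsElliptic] [W.IsGloballyMinimal] hp in
/-- Reading a congruence `g • m − s • m ∈ M⁺` (all `m ∈ E[p^∞]`) inside `E[p]`:
`g • P − s • P ∈ X₀`. [folklore] -/
theorem smul_sub_zsmul_mem_comap {g : absoluteGaloisGroup ℚ} {s : ℤ}
    (h : ∀ m : W.geomPrimaryTorsion p, g • m - s • m ∈ N.plus) (P : geomTorsion W (p : ℤ)) :
    g • P - s • P ∈ N.plus.comap (AddSubgroup.inclusion (geomTorsion_le_geomPrimaryTorsion W p)) := by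
  rw [mem_comap_iff, map_sub, map_zsmul, inclusion_smul]
  exact h _

omit [W.IsElliptic] [W.IsGloballyMinimal] in
/-- In a subgroup of the `p`-torsion (`p` odd), `2 • P ∈ X ⇒ P ∈ X` (`P = ((p+1)/2) • (2 • P)`).
[folklore] -/
theorem mem_of_two_nsmul_mem (hp2 : p ≠ 2) (X : AddSubgroup (geomTorsion W (p : ℤ)))
    {P : geomTorsion W (p : ℤ)} (h2 : (2 : ℕ) • P ∈ X) : P ∈ X := by
  have hodd : p % 2 = 1 := Nat.odd_iff.mp (hp.out.odd_of_ne_two hp2)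
  have h2dvd : 2 ∣ p + 1 := by omega
  have hpP : p • P = 0 := AddSubgroup.torsionBy.nsmul P
  have key : ((p + 1) / 2) • ((2 : ℕ) • P) = P := by
    rw [smul_smul, Nat.div_mul_cancel h2dvd, add_smul, one_smul, hpP, zero_add]
  rw [← key]
  exact X.nsmul_mem h2 _

end Line

/-! ## §2. A line meets `X₀` trivially or equals it -/

omit [W.IsElliptic] [W.IsGloballyMinimal] in
/-- Two subgroups of order `p` of `E[p]`: `Φ ⊓ X = ⊥` or `Φ = X` (x1a's
`Rank1Residual.inf_eq_bot_or_eq_of_card`). [folklore] -/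
theorem inf_eq_bot_or_eq {Φ X : AddSubgroup (geomTorsion W (p : ℤ))} (hΦ : Nat.card Φ = p)
    (hX : Nat.card X = p) : Φ ⊓ X = ⊥ ∨ Φ = X := by
  have hpp : p.Prime := hp.out
  haveI : Finite Φ := Nat.finite_of_card_ne_zero (by rw [hΦ]; exact hpp.ne_zero)
  haveI : Finite X := Nat.finite_of_card_ne_zero (by rw [hX]; exact hpp.ne_zero)
  haveI : Finite (Φ ⊓ X : AddSubgroup _) :=
    Finite.of_injective _ (AddSubgroup.inclusion_injective (inf_le_left : Φ ⊓ X ≤ Φ))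
  have hcard : Nat.card (Φ ⊓ X : AddSubgroup _) ∣ p := by
    have h := AddSubgroup.card_dvd_of_le (inf_le_left : Φ ⊓ X ≤ Φ)
    rwa [hΦ] at h
  rcases (Nat.dvd_prime hpp).mp hcard with h1 | h2
  · exact Or.inl (AddSubgroup.eq_bot_of_card_eq _ h1)
  · right
    have heq : (Φ ⊓ X : AddSubgroup _) = Φ :=
      AddSubgroup.eq_of_le_of_card_ge inf_le_left (by rw [hΦ, h2])
    have hΦX : Φ ≤ X := heq ▸ inf_le_right
    exact AddSubgroup.eq_of_le_of_card_ge hΦX (by rw [hΦ, hX])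

/-! ## §3. NON-SPLIT: `D_v` neither fixes a stable line nor acts trivially on the quotient -/

/-- **NON-SPLIT odd `p ‖ N`: for every subgroup `Φ ≤ E₀[p]` of order `p` (stable or not), `D_v`
does NOT fix `Φ` pointwise and does NOT act trivially on `E₀[p]/Φ`** ("`φ|_{G_p} ≠ 1, ω`"), granted the
twisted Tate uniformisation A41 (`hT`). Proof: let `X₀ = C ∩ E₀[p]` (order `p`), `τ ∈ Γ_{ℚ_v}` an
arithmetic Frobenius; `τ` flips `√γ` (non-split), so `res τ • P + P ∈ X₀` for all `P ∈ E₀[p]`; and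
some inertia element moves a point of `X₀`. If `D_v` fixed `Φ`: `Φ = X₀` contradicts the inertia,
`Φ ⊓ X₀ = ⊥` gives `2P ∈ Φ ⊓ X₀` for `P ∈ Φ`, so `Φ = 0`. If `D_v` were trivial on `E₀[p]/Φ`:
`Φ = X₀` gives `2P ∈ X₀` for all `P`, so `X₀ = E₀[p]`; `Φ ⊓ X₀ = ⊥` kills the inertia on `X₀`.
[cite: GreenbergVatsal2000, §2 pp. 14–15]
[cite: SilvermanATAEC1994, Ch. V Lemma 5.2 (c), Thm. 5.3 (a),(b), Cor. 5.4 (held copy PDF pp. 406–410)] -/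
theorem not_fix_and_not_quot_of_not_split
    (hT : Silverman1994_thmV53_corV54_tateUniformisation.{0}) (hp2 : p ≠ 2)
    (hmult : W.HasMultiplicativeReductionAtPrime p)
    (hns : ¬ W.HasSplitMultiplicativeReductionAtPrime p) (hpv : ((p : ℕ) : 𝓞 ℚ) ∈ v.asIdeal)
    {Φ : AddSubgroup (geomTorsion W (p : ℤ))} (hΦ : Nat.card Φ = p) :
    (¬ ∀ g ∈ decomp (K := ℚ) v, ∀ P ∈ Φ, g • P = P) ∧
      (¬ ∀ g ∈ decomp (K := ℚ) v, ∀ P : geomTorsion W (p : ℤ), g • P - P ∈ Φ) := by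
  have hpp := hp.out
  -- the twisted Tate parametrisation above `v`
  obtain ⟨q, t, Ψ, hq0, hq1, ht0, ht2, hsurj, hker, hΨσ, -⟩ :=
    hT W v (GreenbergVatsalStrictSelmerMultiplicative.hasMultiplicativeReductionAt_of_mem W p hmult hpv)
  have hker' : ∀ u : (AlgebraicClosure (v.adicCompletion ℚ))ˣ, Ψ (Additive.ofMul u) = 0 →
      ∃ a : ℤ, (u : AlgebraicClosure (v.adicCompletion ℚ)) =
        algebraMap (v.adicCompletion ℚ) (AlgebraicClosure (v.adicCompletion ℚ)) q ^ a :=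
    fun u h ↦ (hker u).1 h
  have hΨI : ∀ σ ∈ absInertia (v.adicCompletion ℚ),
      ∀ u : (AlgebraicClosure (v.adicCompletion ℚ))ˣ,
      σ • Ψ (Additive.ofMul u) = Ψ (Additive.ofMul (Units.map
        (Field.absoluteGaloisGroup.toAlgEquiv (v.adicCompletion ℚ) σ :
          AlgebraicClosure (v.adicCompletion ℚ) →* AlgebraicClosure (v.adicCompletion ℚ)) u)) := by
    intro σ hσ u
    rw [hΨσ σ u, if_pos (GreenbergVatsalTateDatumRat.inertia_fix_sqrt_gamma W hp2 hmult hpv t ht2 σ hσ),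
      one_zsmul]
  set N := tateDatum W p Ψ (sign_disj W Ψ t hΨσ) with hN
  set X := N.plus.comap (AddSubgroup.inclusion (geomTorsion_le_geomPrimaryTorsion W p)) with hXdef
  -- `#X₀ = p`
  have hXcard : Nat.card X = p := by
    rw [hXdef, natCard_comap_eq W p N, hN]
    exact natCard_tateDatum_plus_inf_torsionBy W p Ψ _ hq0 hq1 hker'
  haveI hXfin : Finite X := Nat.finite_of_card_ne_zero (by rw [hXcard]; exact hpp.ne_zero)
  -- a Frobenius flipping `t`: `res τ • P + P ∈ X₀`
  obtain ⟨𝔐, h𝔐⟩ := v.localPrimesAbove_nonempty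
  obtain ⟨τ, hτ⟩ := IsDedekindDomain.HeightOneSpectrum.exists_isArithFrobAt_localAbsIntegers v h𝔐
  have hflip := frob_apply_sqrt_gamma_ne W hp2 hmult hns hpv h𝔐 hτ t ht0 ht2
  have hδX : ∀ P : geomTorsion W (p : ℤ),
      absGaloisRestrict ℚ (v.adicCompletion ℚ) τ • P - (-1 : ℤ) • P ∈ X := by
    refine smul_sub_zsmul_mem_comap W p N (fun m ↦ ?_)
    have h := smul_sub_sign_smul_mem W p Ψ t hΨσ hsurj hker' τ m
    rwa [if_neg hflip] at h
  have hδD : absGaloisRestrict ℚ (v.adicCompletion ℚ) τ ∈ decomp (K := ℚ) v := ⟨τ, rfl⟩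
  -- inertia moves `X₀`
  have hX1 : 1 < Nat.card X := by rw [hXcard]; exact hpp.one_lt
  haveI : Nontrivial X := Finite.one_lt_card_iff_nontrivial.mp hX1
  obtain ⟨⟨P₁, hP₁X⟩, hP₁0⟩ := exists_ne (0 : X)
  have hP₁0' : P₁ ≠ 0 := fun h ↦ hP₁0 (Subtype.ext h)
  obtain ⟨ι, hι, Q, hQX, hιQ⟩ := exists_mem_inertia_smul_ne_of_hgen W p N
    (tateDatum_hgen W p Ψ _ hq0 hq1 hker' hΨI hp2 hpv) hP₁X hP₁0'
  have hιD : ι ∈ decomp (K := ℚ) v := by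
    obtain ⟨σ, -, rfl⟩ := Subgroup.mem_map.mp hι
    exact ⟨σ, rfl⟩
  -- `X₀` is `I_v`-stable: `ι • Q − Q ∈ X₀`
  have hιQX : ι • Q - Q ∈ X := X.sub_mem (smul_mem_comap_of_mem_decomp W p N hιD hQX) hQX
  refine ⟨fun hfix ↦ ?_, fun hquot ↦ ?_⟩
  · -- (1) `D_v` fixes `Φ` pointwise
    rcases inf_eq_bot_or_eq W p hΦ hXcard with hbot | heq
    · -- `Φ ⊓ X₀ = ⊥`: for `P ∈ Φ`, `2P = (res τ • P + P) ∈ X₀ ∩ Φ`, so `Φ = 0`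
      haveI : Finite Φ := Nat.finite_of_card_ne_zero (by rw [hΦ]; exact hpp.ne_zero)
      have hΦ1 : 1 < Nat.card Φ := by rw [hΦ]; exact hpp.one_lt
      haveI : Nontrivial Φ := Finite.one_lt_card_iff_nontrivial.mp hΦ1
      obtain ⟨⟨P, hPΦ⟩, hP0⟩ := exists_ne (0 : Φ)
      have h2X : (2 : ℕ) • P ∈ X := by
        have h := hδX P
        rw [hfix _ hδD P hPΦ, neg_one_zsmul, sub_neg_eq_add, ← two_nsmul] at h
        exact h
      have h2 : (2 : ℕ) • P ∈ (Φ ⊓ X : AddSubgroup _) := ⟨Φ.nsmul_mem hPΦ _, h2X⟩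
      rw [hbot, AddSubgroup.mem_bot] at h2
      have hP : P ∈ (⊥ : AddSubgroup (geomTorsion W (p : ℤ))) :=
        mem_of_two_nsmul_mem W p hp2 ⊥ (by rw [h2]; exact AddSubgroup.zero_mem _)
      exact hP0 (Subtype.ext ((AddSubgroup.mem_bot).mp hP))
    · -- `Φ = X₀`: the inertia element `ι ∈ D_v` moves `Q ∈ X₀ = Φ`
      exact hιQ (hfix ι hιD Q (heq ▸ hQX))
  · -- (2) `D_v` acts trivially on `E[p]/Φ`
    rcases inf_eq_bot_or_eq W p hΦ hXcard with hbot | heq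
    · -- `Φ ⊓ X₀ = ⊥`: `ι • Q − Q ∈ Φ ⊓ X₀ = 0`
      have h1 : ι • Q - Q ∈ (Φ ⊓ X : AddSubgroup _) := ⟨hquot ι hιD Q, hιQX⟩
      rw [hbot, AddSubgroup.mem_bot, sub_eq_zero] at h1
      exact hιQ h1
    · -- `Φ = X₀`: `2P = (res τ • P + P) − (res τ • P − P) ∈ X₀` for all `P`, so `X₀ = E[p]`
      have hall : ∀ P : geomTorsion W (p : ℤ), P ∈ X := fun P ↦ by
        have ha := hδX P
        have hb : absGaloisRestrict ℚ (v.adicCompletion ℚ) τ • P - P ∈ X := heq ▸ hquot _ hδD P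
        have h2 : (2 : ℕ) • P ∈ X := by
          have := X.sub_mem ha hb
          rw [neg_one_zsmul, sub_neg_eq_add, show absGaloisRestrict ℚ (v.adicCompletion ℚ) τ • P + P -
            (absGaloisRestrict ℚ (v.adicCompletion ℚ) τ • P - P) = (2 : ℕ) • P by
              rw [two_nsmul]; abel] at this
          exact this
        exact mem_of_two_nsmul_mem W p hp2 X h2
      have htop : X = ⊤ := by
        ext P; exact ⟨fun _ ↦ trivial, fun _ ↦ hall P⟩
      have hcard := hXcard
      rw [htop, AddSubgroup.card_top, Literature.NumberTheory.EllipticCurves.natCard_geomTorsion W p] at hcard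
      have : p ^ 2 = p ^ 1 := by rw [pow_one]; exact hcard
      exact absurd (Nat.pow_right_injective hpp.two_le this) (by norm_num)

/-! ## §4. SPLIT: `D_v` fixes a stable line or acts trivially on the quotient -/

omit [W.IsGloballyMinimal] in
/-- **SPLIT odd `p ‖ N`: for every `D_v`-stable subgroup `Φ ≤ E₀[p]` of order `p`, `D_v` fixes `Φ`
pointwise OR acts trivially on `E₀[p]/Φ`** ("`φ|_{G_p} ∈ {1, ω}`"), granted the Tate uniformisation
A40 (`hT`): `D_v` acts trivially on `E₀[p^∞]/C` (untwisted parametrisation), so `g • P − P ∈ X₀` for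
all `g ∈ D_v`, `P ∈ E₀[p]`; if `Φ = X₀` this is the second clause, and if `Φ ⊓ X₀ = ⊥` then for
`P ∈ Φ` the element `g • P − P ∈ Φ ⊓ X₀` vanishes. [cite: GreenbergVatsal2000, §2 pp. 14–15]
[cite: SilvermanATAEC1994, Ch. V Thm. 3.1 (c),(d) p. 423 and §V.5 Thm. 5.3 (a),(b)] -/
theorem fix_or_quot_of_split (hT : Silverman1994_thmV53_tateUniformisation.{0})
    (hsplit : W.HasSplitMultiplicativeReductionAtPrime p) (hpv : ((p : ℕ) : 𝓞 ℚ) ∈ v.asIdeal)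
    {Φ : AddSubgroup (geomTorsion W (p : ℤ))} (hΦ : Nat.card Φ = p)
    (hΦst : ∀ g ∈ decomp (K := ℚ) v, ∀ P ∈ Φ, g • P ∈ Φ) :
    (∀ g ∈ decomp (K := ℚ) v, ∀ P ∈ Φ, g • P = P) ∨
      (∀ g ∈ decomp (K := ℚ) v, ∀ P : geomTorsion W (p : ℤ), g • P - P ∈ Φ) := by
  have hpp := hp.out
  obtain ⟨q, Ψ, hq0, hq1, hsurj, hker, hΨσ, -⟩ :=
    hT W v (GreenbergVatsalStrictSelmerMultiplicative.hasSplitMultiplicativeReductionAt_of_mem W p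
      hsplit hpv)
  have hker' : ∀ u : (AlgebraicClosure (v.adicCompletion ℚ))ˣ, Ψ (Additive.ofMul u) = 0 →
      ∃ a : ℤ, (u : AlgebraicClosure (v.adicCompletion ℚ)) =
        algebraMap (v.adicCompletion ℚ) (AlgebraicClosure (v.adicCompletion ℚ)) q ^ a :=
    fun u h ↦ (hker u).1 h
  set N := tateDatum W p Ψ (sign_disj W Ψ 0 (sign_of_equivariant W Ψ hΨσ)) with hN
  set X := N.plus.comap (AddSubgroup.inclusion (geomTorsion_le_geomPrimaryTorsion W p)) with hXdef
  have hXcard : Nat.card X = p := by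
    rw [hXdef, natCard_comap_eq W p N, hN]
    exact natCard_tateDatum_plus_inf_torsionBy W p Ψ _ hq0 hq1 hker'
  -- `D_v` acts trivially on `E[p]/X₀`
  have hDX : ∀ g ∈ decomp (K := ℚ) v, ∀ P : geomTorsion W (p : ℤ), g • P - P ∈ X := by
    rintro g ⟨σ, rfl⟩ P
    have h := smul_sub_zsmul_mem_comap W p N (g := absGaloisRestrict ℚ (v.adicCompletion ℚ) σ)
      (s := 1) (fun m ↦ by
        rw [one_zsmul]; exact smul_sub_mem_of_equivariant W p Ψ hΨσ hsurj hker' σ m) P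
    rwa [one_zsmul] at h
  rcases inf_eq_bot_or_eq W p hΦ hXcard with hbot | heq
  · left
    intro g hg P hP
    have h1 : g • P - P ∈ (Φ ⊓ X : AddSubgroup _) := ⟨Φ.sub_mem (hΦst g hg P hP) hP, hDX g hg P⟩
    rw [hbot, AddSubgroup.mem_bot, sub_eq_zero] at h1
    exact h1
  · right
    rw [heq]
    exact hDX

end Summit.BirchSwinnertonDyer.Rank1Residual.X2.TateLineDecomposition

end
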